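import Summits.CriticalPhenomena.PercolationContinuityZ3.Theorems.Transplant.FKConnectivityAllQAntipodalCellAlgebra
import HarnessLib

/-!
# Connectivity correlation inequalities for `φ_{w,q}`, every `q > 0` — file 45b: **`C_∞` AT LEVEL ≤ 3 IN EVERY CELL** (every coefficient)

Support file (`--supports stmt-CriticalPhenomena-4575`), FK sub-lane `prim-bschramm-fk-2` (gen 20); builds on p205010 (kernel theorem,
internal audit signed; external expert review pending).  No definitions, no named facts, no sorries; standard axioms.

**`FK.apPsiC_level3_sub_nonpos_of_isTTSP`**: `E` TTSP between `s, t`, `st ∉ E`, `H = E ∪ {st}`; live `M ⊆ H` and contracted `C ⊆ H` disjoint;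
`x, y, z ∈ M` distinct; `0 < q ≤ 1`; `f` increasing on the subsets of `{x,y,z}` reading no other edge; `g` increasing on the subsets of `M`,
reading none of `x, y, z` nor the edges of `C` ⟹ `apPsiC q M C f g ≤ 0` — the coefficient `[z^{2·1_C + 1_M}] Z_H² Cov_{φ_{z,q}}(f, g)` is `≤ 0`
for EVERY cell `(C, M)`: gen 10's Conjecture `C_∞` for `min(|supp f|,|supp g|) ≤ 3` in EVERY coefficient on every 2-connected series–parallel
graph (file 35's algebra with a contracted set, file 45a; inputs: AND and U in every cell at any position, file 45a, and U¹¹ in every cell,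
file 44b).  Also `FK.apPsiC_level1_sub_nonpos_of_isTTSP` (one read edge, scaled Theorem U) for the cell analysis of the value-level file 45c.
[cite: Grimmett2006, §1.4 eq. (1.20) (p. 15); §3.8 Thm. (3.90) (pp. 61–62); §3.9 (pp. 63–64)] [cite: Wagner2006, Thm. 5.8(d), §5.3]
-/

noncomputable section

namespace Summit.CriticalPhenomena.PercolationContinuityZ3.Theorems

namespace FK

open Literature.Probability.LatticeModels Literature.Probability.Percolation
open scoped Classical

universe u

variable {V : Type u} [Fintype V] {s t : V}

/-- **`C_∞` AT LEVEL ≤ 3 IN EVERY CELL** (`0 < q ≤ 1`) — see the module docstring. [cite: Grimmett2006, §3.8 Thm. (3.90) (pp. 61–62); §3.9 (pp. 63–64)] -/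
theorem apPsiC_level3_sub_nonpos_of_isTTSP {q : ℝ} (hq0 : 0 < q) (hq1 : q ≤ 1) {E : Finset (Sym2 V)} (hE : IsTTSP E s t)
    (hst : s(s, t) ∉ E) {M C : Finset (Sym2 V)} (hM : M ⊆ insert s(s, t) E) (hC : C ⊆ insert s(s, t) E) (hMC : Disjoint M C)
    {x y z : Sym2 V} (hx : x ∈ M) (hy : y ∈ M) (hz : z ∈ M)
    (hxy : x ≠ y) (hxz : x ≠ z) (hyz : y ≠ z) {f g : Finset (Sym2 V) → ℝ}
    (hf : ∀ e : Sym2 V, e ∉ ({x, y, z} : Finset (Sym2 V)) → ∀ A : Finset (Sym2 V), f (insert e A) = f A)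
    (hfmono : ∀ ⦃A B : Finset (Sym2 V)⦄, A ⊆ B → B ⊆ ({x, y, z} : Finset (Sym2 V)) → f A ≤ f B)
    (hgx : ∀ A : Finset (Sym2 V), g (insert x A) = g A) (hgy : ∀ A : Finset (Sym2 V), g (insert y A) = g A)
    (hgz : ∀ A : Finset (Sym2 V), g (insert z A) = g A) (hgC : ∀ e ∈ C, ∀ A : Finset (Sym2 V), g (insert e A) = g A)
    (hmono : ∀ ⦃A B : Finset (Sym2 V)⦄, A ⊆ B → B ⊆ M → g A ≤ g B) :
    apPsiC q M C f g ≤ 0 := by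
  have hxC : x ∉ C := fun h => Finset.disjoint_left.1 hMC hx h
  have hyC : y ∉ C := fun h => Finset.disjoint_left.1 hMC hy h
  have hzC : z ∉ C := fun h => Finset.disjoint_left.1 hMC hz h
  set H := M with hH
  -- the four AND functionals and their signs
  have hS3 : ({x, y, z} : Finset (Sym2 V)) ⊆ H := by simp [Finset.insert_subset_iff, hx, hy, hz]
  have hSxy : ({x, y} : Finset (Sym2 V)) ⊆ H := by simp [Finset.insert_subset_iff, hx, hy]
  have hSxz : ({x, z} : Finset (Sym2 V)) ⊆ H := by simp [Finset.insert_subset_iff, hx, hz]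
  have hSyz : ({y, z} : Finset (Sym2 V)) ⊆ H := by simp [Finset.insert_subset_iff, hy, hz]
  have ng3 : ∀ e ∈ ({x, y, z} : Finset (Sym2 V)), ∀ A : Finset (Sym2 V), g (insert e A) = g A := by
    intro e he A; simp only [Finset.mem_insert, Finset.mem_singleton] at he
    rcases he with rfl | rfl | rfl
    exacts [hgx A, hgy A, hgz A]
  have ngxy : ∀ e ∈ ({x, y} : Finset (Sym2 V)), ∀ A : Finset (Sym2 V), g (insert e A) = g A := fun e he A =>
    ng3 e (by simp only [Finset.mem_insert, Finset.mem_singleton] at he ⊢; tauto) A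
  have ngxz : ∀ e ∈ ({x, z} : Finset (Sym2 V)), ∀ A : Finset (Sym2 V), g (insert e A) = g A := fun e he A =>
    ng3 e (by simp only [Finset.mem_insert, Finset.mem_singleton] at he ⊢; tauto) A
  have ngyz : ∀ e ∈ ({y, z} : Finset (Sym2 V)), ∀ A : Finset (Sym2 V), g (insert e A) = g A := fun e he A =>
    ng3 e (by simp only [Finset.mem_insert, Finset.mem_singleton] at he ⊢; tauto) A
  have aS := apPsiC_andSet_sub_nonpos_of_isTTSP hq0 hq1 hE hst hM hC hMC hS3 ⟨x, by simp⟩ ng3 hgC hmono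
  have axy := apPsiC_andSet_sub_nonpos_of_isTTSP hq0 hq1 hE hst hM hC hMC hSxy ⟨x, by simp⟩ ngxy hgC hmono
  have axz := apPsiC_andSet_sub_nonpos_of_isTTSP hq0 hq1 hE hst hM hC hMC hSxz ⟨x, by simp⟩ ngxz hgC hmono
  have ayz := apPsiC_andSet_sub_nonpos_of_isTTSP hq0 hq1 hE hst hM hC hMC hSyz ⟨y, by simp⟩ ngyz hgC hmono
  -- Theorem U at x, y, z as relations among the AND functionals
  have ux := apPsiC_pivot_sub_nonpos_of_isTTSP hq0 hq1 hE hst hM hC hMC hx hgx hgC hmono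
  have uy := apPsiC_pivot_sub_nonpos_of_isTTSP hq0 hq1 hE hst hM hC hMC hy hgy hgC hmono
  have uz := apPsiC_pivot_sub_nonpos_of_isTTSP hq0 hq1 hE hst hM hC hMC hz hgz hgC hmono
  rw [apPsiC_pivot_eq_ands q hx hy hz hxC hyC hzC hxy hxz] at ux
  rw [apPsiC_pivot_eq_ands q hy hx hz hyC hxC hzC hxy.symm hyz, Finset.pair_comm y x] at uy
  rw [apPsiC_pivot_eq_ands q hz hx hy hzC hxC hyC hxz.symm hyz.symm, Finset.pair_comm z x, Finset.pair_comm z y] at uz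
  -- U¹¹ at x, y, z as relations among the AND functionals
  have vx := apPsiC_pivot_split_sub_nonpos_of_isTTSP hq0 hq1 hE hst hM hC hMC hx hy hz hxy hxz hyz hgx hgy hgz hgC hmono
  have vy := apPsiC_pivot_split_sub_nonpos_of_isTTSP hq0 hq1 hE hst hM hC hMC hy hx hz hxy.symm hyz hxz hgy hgx hgz hgC hmono
  have vz := apPsiC_pivot_split_sub_nonpos_of_isTTSP hq0 hq1 hE hst hM hC hMC hz hx hy hxz.symm hyz.symm hxy hgz hgx hgy hgC hmono
  rw [apPsiC_pivot_split_eq_ands q hx hy hz hxC hyC hzC hxy hxz hyz] at vx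
  rw [apPsiC_pivot_split_eq_ands q hy hx hz hyC hxC hzC hxy.symm hyz hxz, Finset.pair_comm y x, Finset.insert_comm y x] at vy
  rw [apPsiC_pivot_split_eq_ands q hz hx hy hzC hxC hyC hxz.symm hyz.symm hxy, Finset.pair_comm z x, Finset.pair_comm z y,
    Finset.insert_comm z x, Finset.pair_comm z y] at vz
  -- monotonicity of f on the subsets of {x, y, z}
  have sub : ∀ A : Finset (Sym2 V), (∀ e ∈ A, e = x ∨ e = y ∨ e = z) → A ⊆ ({x, y, z} : Finset (Sym2 V)) := fun A hA e he => by
    simp only [Finset.mem_insert, Finset.mem_singleton]; exact hA e he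
  have m1 : f {x} ≤ f {x, y, z} := hfmono (by intro e; simp only [Finset.mem_insert, Finset.mem_singleton]; tauto) (sub _ (by simp))
  have m2 : f ∅ ≤ f {y, z} := hfmono (Finset.empty_subset _) (sub _ (by simp))
  have m3 : f {y, z} ≤ f {x, y, z} := hfmono (by intro e; simp only [Finset.mem_insert, Finset.mem_singleton]; tauto) (sub _ (by simp))
  have m4 : f ∅ ≤ f {x} := hfmono (Finset.empty_subset _) (sub _ (by simp))
  have m5 : f {y} ≤ f {x, y, z} := hfmono (by intro e; simp only [Finset.mem_insert, Finset.mem_singleton]; tauto) (sub _ (by simp))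
  have m6 : f ∅ ≤ f {x, z} := hfmono (Finset.empty_subset _) (sub _ (by simp))
  have m7 : f {x, z} ≤ f {x, y, z} := hfmono (by intro e; simp only [Finset.mem_insert, Finset.mem_singleton]; tauto) (sub _ (by simp))
  have m8 : f ∅ ≤ f {y} := hfmono (Finset.empty_subset _) (sub _ (by simp))
  have m9 : f {z} ≤ f {x, y, z} := hfmono (by intro e; simp only [Finset.mem_insert, Finset.mem_singleton]; tauto) (sub _ (by simp))
  have m10 : f ∅ ≤ f {x, y} := hfmono (Finset.empty_subset _) (sub _ (by simp))
  have m11 : f {x, y} ≤ f {x, y, z} := hfmono (by intro e; simp only [Finset.mem_insert, Finset.mem_singleton]; tauto) (sub _ (by simp))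
  have m12 : f ∅ ≤ f {z} := hfmono (Finset.empty_subset _) (sub _ (by simp))
  have n1 : f {x} ≤ f {x, y} := hfmono (by intro e; simp only [Finset.mem_insert, Finset.mem_singleton]; tauto) (sub _ (by simp))
  have n2 : f {x} ≤ f {x, z} := hfmono (by intro e; simp only [Finset.mem_insert, Finset.mem_singleton]; tauto) (sub _ (by simp))
  have n3 : f {y} ≤ f {x, y} := hfmono (by intro e; simp only [Finset.mem_insert, Finset.mem_singleton]; tauto) (sub _ (by simp))
  have n4 : f {y} ≤ f {y, z} := hfmono (by intro e; simp only [Finset.mem_insert, Finset.mem_singleton]; tauto) (sub _ (by simp))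
  have n5 : f {z} ≤ f {x, z} := hfmono (by intro e; simp only [Finset.mem_insert, Finset.mem_singleton]; tauto) (sub _ (by simp))
  have n6 : f {z} ≤ f {y, z} := hfmono (by intro e; simp only [Finset.mem_insert, Finset.mem_singleton]; tauto) (sub _ (by simp))
  rw [apPsiC_level3_eq q hx hy hz hxC hyC hzC hf g]
  have key := level3_cone (P := - apPsiC q H C (fun A => if ({x, y, z} : Finset (Sym2 V)) ⊆ A then 1 else 0) g)
    (X := apPsiC q H C (fun A => if ({x, y, z} : Finset (Sym2 V)) ⊆ A then 1 else 0) g -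
      apPsiC q H C (fun A => if ({y, z} : Finset (Sym2 V)) ⊆ A then 1 else 0) g)
    (Y := apPsiC q H C (fun A => if ({x, y, z} : Finset (Sym2 V)) ⊆ A then 1 else 0) g -
      apPsiC q H C (fun A => if ({x, z} : Finset (Sym2 V)) ⊆ A then 1 else 0) g)
    (Z := apPsiC q H C (fun A => if ({x, y, z} : Finset (Sym2 V)) ⊆ A then 1 else 0) g -
      apPsiC q H C (fun A => if ({x, y} : Finset (Sym2 V)) ⊆ A then 1 else 0) g)
    (d0 := f {x, y, z} - f ∅) (dx := f {x} - f {y, z}) (dy := f {y} - f {x, z}) (dz := f {z} - f {x, y})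
    (by linarith) (by linarith) (by linarith) (by linarith) (by linarith) (by linarith) (by linarith)
    (by linarith) (by linarith) (by linarith)
    (abs_le.2 ⟨by linarith, by linarith⟩) (abs_le.2 ⟨by linarith, by linarith⟩) (abs_le.2 ⟨by linarith, by linarith⟩)
    (by linarith) (by linarith) (by linarith)
  linarith



/-- **One read edge, every cell**: `f` reading only `x ∈ M` with `f ∅ ≤ f{x}` ⟹ `apPsiC q M C f g ≤ 0` (`FK.apPsiC_level1_eq` + Theorem U).
[cite: Grimmett2006, §3.9 (pp. 63–64)] -/
theorem apPsiC_level1_sub_nonpos_of_isTTSP {q : ℝ} (hq0 : 0 < q) (hq1 : q ≤ 1) {E : Finset (Sym2 V)} (hE : IsTTSP E s t)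
    (hst : s(s, t) ∉ E) {M C : Finset (Sym2 V)} (hM : M ⊆ insert s(s, t) E) (hC : C ⊆ insert s(s, t) E) (hMC : Disjoint M C)
    {x : Sym2 V} (hx : x ∈ M) {f g : Finset (Sym2 V) → ℝ}
    (hf : ∀ e : Sym2 V, e ∉ ({x} : Finset (Sym2 V)) → ∀ A : Finset (Sym2 V), f (insert e A) = f A) (hf0 : f ∅ ≤ f {x})
    (hgx : ∀ A : Finset (Sym2 V), g (insert x A) = g A) (hgC : ∀ e ∈ C, ∀ A : Finset (Sym2 V), g (insert e A) = g A)
    (hmono : ∀ ⦃A B : Finset (Sym2 V)⦄, A ⊆ B → B ⊆ M → g A ≤ g B) :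
    apPsiC q M C f g ≤ 0 := by
  have hxC : x ∉ C := fun h => Finset.disjoint_left.1 hMC hx h
  rw [apPsiC_level1_eq q hx hxC hf g]
  exact mul_nonpos_of_nonneg_of_nonpos (by linarith) (apPsiC_pivot_sub_nonpos_of_isTTSP hq0 hq1 hE hst hM hC hMC hx hgx hgC hmono)

omit [Fintype V] in
/-- **Level 2 with a contracted set (identity)**: `f` reading only `a, b ∈ M ∖ C` ⟹
`apPsiC q M C f g = (f{a,b} − f∅ − (f{a} − f{b}))·A_{ab} + (f{a} − f{b})·A_a`. [folklore] -/
theorem apPsiC_level2_eq (q : ℝ) {M C : Finset (Sym2 V)} {a b : Sym2 V} (ha : a ∈ M) (hb : b ∈ M) (haC : a ∉ C) (hbC : b ∉ C)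
    {f : Finset (Sym2 V) → ℝ}
    (hf : ∀ e : Sym2 V, e ∉ ({a, b} : Finset (Sym2 V)) → ∀ A : Finset (Sym2 V), f (insert e A) = f A) (g : Finset (Sym2 V) → ℝ) :
    apPsiC q M C f g =
      (f {a, b} - f ∅ - (f {a} - f {b})) * apPsiC q M C (fun A => if ({a, b} : Finset (Sym2 V)) ⊆ A then 1 else 0) g +
        (f {a} - f {b}) * apPsiC q M C (fun A => if a ∈ A then 1 else 0) g := by
  have hfS := eq_inter_of_notRead_outside hf
  rw [← apPsiC_smul_left, ← apPsiC_smul_left]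
  rw [show (apPsiC q M C (fun A => (f {a, b} - f ∅ - (f {a} - f {b})) * (if ({a, b} : Finset (Sym2 V)) ⊆ A then 1 else 0)) g +
      apPsiC q M C (fun A => (f {a} - f {b}) * (if a ∈ A then 1 else 0)) g) =
      apPsiC q M C (fun A => (f {a, b} - f ∅ - (f {a} - f {b})) * (if ({a, b} : Finset (Sym2 V)) ⊆ A then 1 else 0) +
        (f {a} - f {b}) * (if a ∈ A then 1 else 0)) g by
    unfold apPsiC; rw [← Finset.sum_add_distrib]; exact Finset.sum_congr rfl fun γ _ => by ring]
  refine apPsiC_congr_odd q g fun γ _ => ?_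
  have hac : a ∈ M \ γ ↔ a ∉ γ := by rw [Finset.mem_sdiff]; exact ⟨fun h => h.2, fun h => ⟨ha, h⟩⟩
  have hbc : b ∈ M \ γ ↔ b ∉ γ := by rw [Finset.mem_sdiff]; exact ⟨fun h => h.2, fun h => ⟨hb, h⟩⟩
  rw [hfS (γ ∪ C), hfS (M \ γ ∪ C), Finset.inter_comm (γ ∪ C), Finset.inter_comm (M \ γ ∪ C)]
  by_cases p : a ∈ γ <;> by_cases r : b ∈ γ <;>
  simp only [Finset.inter_insert, Finset.singleton_inter, Finset.mem_union, hac, hbc, haC, hbC, p, r,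
    Finset.insert_empty, Finset.insert_subset_iff, Finset.singleton_subset_iff, or_false, if_true, if_false,
    not_true_eq_false, not_false_eq_true, and_true, and_false, and_self] <;> ring

/-- **Level 2 in every cell** (`0 < q ≤ 1`): `f` increasing on the subsets of `{a,b}` reading no other edge, `a ≠ b ∈ M`, `g` increasing on the
subsets of `M` reading neither `a, b` nor the edges of `C` ⟹ `apPsiC q M C f g ≤ 0` (the identity above or its mirror image, by the sign of
`f{a} − f{b}`; AND and Theorem U in every cell). [cite: Grimmett2006, §3.8 Thm. (3.90) (pp. 61–62); §3.9 (pp. 63–64)] -/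
theorem apPsiC_level2_sub_nonpos_of_isTTSP {q : ℝ} (hq0 : 0 < q) (hq1 : q ≤ 1) {E : Finset (Sym2 V)} (hE : IsTTSP E s t)
    (hst : s(s, t) ∉ E) {M C : Finset (Sym2 V)} (hM : M ⊆ insert s(s, t) E) (hC : C ⊆ insert s(s, t) E) (hMC : Disjoint M C)
    {a b : Sym2 V} (ha : a ∈ M) (hb : b ∈ M) (hab : a ≠ b) {f g : Finset (Sym2 V) → ℝ}
    (hf : ∀ e : Sym2 V, e ∉ ({a, b} : Finset (Sym2 V)) → ∀ A : Finset (Sym2 V), f (insert e A) = f A)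
    (hfmono : ∀ ⦃A B : Finset (Sym2 V)⦄, A ⊆ B → B ⊆ ({a, b} : Finset (Sym2 V)) → f A ≤ f B)
    (hga : ∀ A : Finset (Sym2 V), g (insert a A) = g A) (hgb : ∀ A : Finset (Sym2 V), g (insert b A) = g A)
    (hgC : ∀ e ∈ C, ∀ A : Finset (Sym2 V), g (insert e A) = g A)
    (hmono : ∀ ⦃A B : Finset (Sym2 V)⦄, A ⊆ B → B ⊆ M → g A ≤ g B) :
    apPsiC q M C f g ≤ 0 := by
  have haC : a ∉ C := fun h => Finset.disjoint_left.1 hMC ha h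
  have hbC : b ∉ C := fun h => Finset.disjoint_left.1 hMC hb h
  have sub : ∀ A : Finset (Sym2 V), (∀ e ∈ A, e = a ∨ e = b) → A ⊆ ({a, b} : Finset (Sym2 V)) := fun A hA e he => by
    simp only [Finset.mem_insert, Finset.mem_singleton]; exact hA e he
  have m1 : f ∅ ≤ f {a} := hfmono (Finset.empty_subset _) (sub _ (by simp))
  have m2 : f ∅ ≤ f {b} := hfmono (Finset.empty_subset _) (sub _ (by simp))
  have m3 : f {a} ≤ f {a, b} := hfmono (by intro e; simp only [Finset.mem_insert, Finset.mem_singleton]; tauto) (sub _ (by simp))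
  have m4 : f {b} ≤ f {a, b} := hfmono (by intro e; simp only [Finset.mem_insert, Finset.mem_singleton]; tauto) (sub _ (by simp))
  have hAab := apPsiC_andSet_sub_nonpos_of_isTTSP hq0 hq1 hE hst hM hC hMC (S := ({a, b} : Finset (Sym2 V)))
    (by intro e he; simp only [Finset.mem_insert, Finset.mem_singleton] at he; rcases he with rfl | rfl <;> assumption)
    ⟨a, by simp⟩ (fun e he A => by
      simp only [Finset.mem_insert, Finset.mem_singleton] at he
      rcases he with rfl | rfl
      · exact hga A
      · exact hgb A) hgC hmono
  have hUa := apPsiC_pivot_sub_nonpos_of_isTTSP hq0 hq1 hE hst hM hC hMC ha hga hgC hmono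
  have hUb := apPsiC_pivot_sub_nonpos_of_isTTSP hq0 hq1 hE hst hM hC hMC hb hgb hgC hmono
  by_cases hd : 0 ≤ f {a} - f {b}
  · rw [apPsiC_level2_eq q ha hb haC hbC hf g]
    nlinarith
  · push Not at hd
    have hf' : ∀ e : Sym2 V, e ∉ ({b, a} : Finset (Sym2 V)) → ∀ A : Finset (Sym2 V), f (insert e A) = f A :=
      fun e he => hf e (by rwa [Finset.pair_comm])
    rw [apPsiC_level2_eq q hb ha hbC haC hf' g, Finset.pair_comm b a]
    nlinarith

omit [Fintype V] in
/-- **No read edge**: `f` reading nothing ⟹ `apPsiC q M C f g = 0`. [folklore] -/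
theorem apPsiC_eq_zero_of_notRead {q : ℝ} {M C : Finset (Sym2 V)} {f : Finset (Sym2 V) → ℝ}
    (hf : ∀ e : Sym2 V, ∀ A : Finset (Sym2 V), f (insert e A) = f A) (g : Finset (Sym2 V) → ℝ) : apPsiC q M C f g = 0 := by
  have hfS := eq_inter_of_notRead_outside (S := (∅ : Finset (Sym2 V))) (fun e _ A => hf e A)
  unfold apPsiC
  refine Finset.sum_eq_zero fun γ _ => ?_
  rw [hfS (γ ∪ C), hfS (M \ γ ∪ C), Finset.inter_empty, Finset.inter_empty, sub_self, zero_mul, mul_zero]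

end FK

end Summit.CriticalPhenomena.PercolationContinuityZ3.Theorems

end
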